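import Summits.ResolutionOfSingularities.ResolutionOfSingularities.Theorems.FrobeniusLadderFInjectiveMacaulayficationFullLastCentreDefs
import HarnessLib

/-!
# A KERNEL CRITERION AGAINST IDEAL-THEORETIC CANONICITY: a second equimultiple coordinate subspace kills `TopLocusIs`
# (crux `FInjectiveMacaulayfication` stmt-ResolutionOfSingularities-15315, chain w45a; res-L1-w45a-plan-1 R26.13 (a) «the canonlast-9 records … are concrete "cc ≠ canonical" witnesses
# (one T-register row, rev 12)», R26.17 idle-serve offer of res-L1-w45a-stub-1 g17 (STATUS 16:13Z); definitions = res-L1-w45a-lead-1 g16 ✓p727906 `FullLastCentreDefs`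
# (`Stage`, `Stage.P`, `Stage.J₃`, `Permissible`, `TopLocusIs`); seat res-L1-w45a-stub-1 g17)

[OURS · L1 W4.5a] Support file (`--supports stmt-ResolutionOfSingularities-15315 --as helper`); theorems only, no definitions, no named fact; NOT a statement of any manuscript; nothing of the
crux is proved. AI-written (AI review is weaker than expert review).

CONTENT. §1 weight bookkeeping for `MvPolynomial` supports (any commutative semiring, any index type): if every monomial of `p` (resp. `q`) has `V`-weight `Σ_{v ∈ V} m_v ≥ d` (resp. `≥ e`)
then so does `p + q` (`≥ min`), `p * q` (`≥ d + e`), `X_v` (`≥ 1` for `v ∈ V`), `X_v^n` (`≥ n`), and — the one analytic input — every monomial of a PARTIAL DERIVATIVE `∂_i p` has `V`-weight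
`≥ d − 1` (`coeff_pderiv`); `V`-weight `≥ 1` on all monomials is membership in the variable ideal `(X_v : v ∈ V)` (`mem_ideal_span_X_image`). §2 for a stage `S` (monic cubic
`P = x³ + b₂x² + b₁x + b₀` in `k[x, y₁, …, y₄]`) PERMISSIBLE along the coordinate subspace `Z′ = V(x, y_n : n ∈ Nor′)` every monomial of `P` has `(x, Nor′)`-weight `≥ 3`, hence
`∂P ≥ 2`, `∂²P ≥ 1`, hence ★ `J₃(P) = (P, ∂P, ∂²P) ⊆ I_{Z′}` (`J₃_le_span_of_permissible`). §3 ★★ `not_topLocusIs_of_permissible`: if `X` is normally flat of multiplicity 3 along some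
coordinate subspace `Z′ ⊄ Z` (i.e. `Permissible S Nor′` with some `n ∈ Nor ∖ Nor′`), then `Z` is NOT the top locus near `x` in the sense of `TopLocusIs S Nor` — for `g·y_n^M ∈ J₃ ⊆ I_{Z′}`
forces `coeff₀ g = 0`. No primality, no Nullstellensatz, any field. Used by `…FullLastCentreBed178TopLocus` to make the register row «cc ≠ canonical at bed 178» kernel-level (the e₁-axis is
a second triple axis through `x₃`). [folklore]
-/

-- single-problem summit: the doubled namespace component is forced
set_option linter.dupNamespace false

noncomputable section

open MvPolynomial Finsupp

namespace Summit.ResolutionOfSingularities.ResolutionOfSingularities.Theorems.FInjectiveMacaulayfication.LastCentreTopLocus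

open Summit.ResolutionOfSingularities.ResolutionOfSingularities.Theorems.FInjectiveMacaulayfication LastCentreDefs

/-! ## §1 Weight bookkeeping on supports -/

section Weights

variable {σ R : Type*} [CommSemiring R] (V : Finset σ)

/-- Weights add on exponent vectors. [plumbing] -/
theorem weight_add (a b : σ →₀ ℕ) : ∑ v ∈ V, (a + b) v = ∑ v ∈ V, a v + ∑ v ∈ V, b v := by
  simp only [Finsupp.coe_add, Pi.add_apply, Finset.sum_add_distrib]

/-- The weight of `ε_i` is `1` if `i ∈ V` and `0` otherwise; in any case `≤ 1`. [plumbing] -/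
theorem weight_single_le (i : σ) : ∑ v ∈ V, (Finsupp.single i 1 : σ →₀ ℕ) v ≤ 1 := by
  classical
  simp only [Finsupp.single_apply, Finset.sum_ite_eq]
  split_ifs <;> omega

/-- SUM: a lower weight bound on both summands passes to the sum. [plumbing] -/
theorem weight_add_le {p q : MvPolynomial σ R} {d : ℕ} (hp : ∀ m ∈ p.support, d ≤ ∑ v ∈ V, m v) (hq : ∀ m ∈ q.support, d ≤ ∑ v ∈ V, m v) :
    ∀ m ∈ (p + q).support, d ≤ ∑ v ∈ V, m v := by
  classical
  intro m hm
  rcases Finset.mem_union.mp (MvPolynomial.support_add hm) with h | h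
  · exact hp m h
  · exact hq m h

/-- PRODUCT: lower weight bounds add under multiplication. [plumbing] -/
theorem weight_mul_le {p q : MvPolynomial σ R} {d e : ℕ} (hp : ∀ m ∈ p.support, d ≤ ∑ v ∈ V, m v) (hq : ∀ m ∈ q.support, e ≤ ∑ v ∈ V, m v) :
    ∀ m ∈ (p * q).support, d + e ≤ ∑ v ∈ V, m v := by
  classical
  intro m hm
  obtain ⟨a, ha, b, hb, rfl⟩ := Finset.mem_add.mp (MvPolynomial.support_mul p q hm)
  rw [weight_add]
  exact Nat.add_le_add (hp a ha) (hq b hb)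

/-- A variable of `V` has weight `≥ 1`. [plumbing] -/
theorem weight_X_pow [Nontrivial R] {i : σ} (hi : i ∈ V) (n : ℕ) : ∀ m ∈ (X i ^ n : MvPolynomial σ R).support, n ≤ ∑ v ∈ V, m v := by
  intro m hm
  rw [support_X_pow, Finset.mem_singleton] at hm
  subst hm
  have h : ∑ v ∈ V, (Finsupp.single i n : σ →₀ ℕ) v = n := by
    rw [Finset.sum_eq_single_of_mem i hi (fun v _ hv => by simp [Ne.symm hv])]
    simp
  rw [h]

/-- ★ THE ANALYTIC INPUT: a partial derivative lowers the weight by at most one — every monomial `m` of `∂_i p` has `m + ε_i ∈ supp p` (`coeff_pderiv`). [plumbing] -/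
theorem weight_pderiv_le {p : MvPolynomial σ R} {d : ℕ} (hp : ∀ m ∈ p.support, d ≤ ∑ v ∈ V, m v) (i : σ) :
    ∀ m ∈ (pderiv i p).support, d - 1 ≤ ∑ v ∈ V, m v := by
  intro m hm
  rw [MvPolynomial.mem_support_iff, coeff_pderiv] at hm
  have hm' : m + Finsupp.single i 1 ∈ p.support := by
    rw [MvPolynomial.mem_support_iff]
    intro h0
    exact hm (by rw [h0, zero_mul])
  have h1 := hp _ hm'
  rw [weight_add] at h1
  have h2 := weight_single_le V i
  omega

/-- Weight `≥ 1` on every monomial is membership in the variable ideal `(X_v : v ∈ V)`. [plumbing; `mem_ideal_span_X_image`] -/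
theorem mem_span_X_of_weight {p : MvPolynomial σ R} (hp : ∀ m ∈ p.support, 1 ≤ ∑ v ∈ V, m v) :
    p ∈ Ideal.span (MvPolynomial.X '' (V : Set σ) : Set (MvPolynomial σ R)) := by
  rw [mem_ideal_span_X_image]
  intro m hm
  have h : ∑ v ∈ V, m v ≠ 0 := by have := hp m hm; omega
  obtain ⟨i, hi, hne⟩ := Finset.exists_ne_zero_of_sum_ne_zero h
  exact ⟨i, hi, hne⟩

end Weights

/-! ## §2 The cubic of a stage: `(x, Nor′)`-weights from permissibility, and `J₃(P) ⊆ I_{Z′}` -/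

section Cubic

variable {k : Type} [Field k]

/-- Transport of normal degrees to the five-letter ring: every monomial of `rename some q` has `(x, Nor′)`-weight equal to the `Nor′`-normal degree of the
corresponding monomial of `q`. [plumbing] -/
theorem weight_rename (Nor' : Finset Letter) (q : YPoly k) {d : ℕ} (hq : ∀ e ∈ q.support, d ≤ norDeg Nor' e) :
    ∀ m ∈ (rename Option.some q).support, d ≤ ∑ v ∈ insert none (Nor'.image Option.some), m v := by
  classical
  intro m hm
  rw [support_rename_of_injective (Option.some_injective _), Finset.mem_image] at hm
  obtain ⟨e, he, rfl⟩ := hm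
  rw [Finset.sum_insert (by simp), Finset.sum_image (fun a _ b _ h => Option.some_injective _ h),
    Finsupp.mapDomain_notin_range _ _ (by simp)]
  simp only [Finsupp.mapDomain_apply (Option.some_injective _), zero_add]
  exact hq e he

/-- Every monomial of the cubic `P` of a stage permissible along `Z′ = V(x, y_n : n ∈ Nor′)` has `(x, Nor′)`-weight `≥ 3` (`P ∈ I_{Z′}³` at the level of supports). [OURS · L1 W4.5a] -/
theorem weight_P_of_permissible (S : Stage k) (Nor' : Finset Letter) (h : Permissible S Nor') :
    ∀ m ∈ S.P.support, 3 ≤ ∑ v ∈ insert none (Nor'.image Option.some), m v := by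
  classical
  have hx : (none : Option Letter) ∈ insert none (Nor'.image Option.some) := Finset.mem_insert_self _ _
  rw [Stage.P]
  refine weight_add_le _ (weight_add_le _ (weight_add_le _ (weight_X_pow _ hx 3) ?_) ?_) (weight_rename Nor' S.b₀ h.2.2)
  · have := weight_mul_le _ (weight_rename Nor' S.b₂ h.1) (weight_X_pow _ hx 2)
    simpa using this
  · have := weight_mul_le _ (weight_rename Nor' S.b₁ h.2.1) (weight_X_pow _ hx 1)
    simpa using this

/-- ★ `J₃(P) = (P, ∂P, ∂²P) ⊆ I_{Z′} = (x, y_n : n ∈ Nor′)` whenever the stage is permissible along `Z′` (weights `3, ≥ 2, ≥ 1`). [OURS · L1 W4.5a] -/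
theorem J₃_le_span_of_permissible (S : Stage k) (Nor' : Finset Letter) (h : Permissible S Nor') :
    S.J₃ ≤ Ideal.span (MvPolynomial.X '' (↑(insert none (Nor'.image Option.some) : Finset (Option Letter)) : Set (Option Letter))) := by
  classical
  have hP := weight_P_of_permissible S Nor' h
  rw [Stage.J₃, Ideal.span_le]
  rintro q ((hq | ⟨i, rfl⟩) | ⟨ij, rfl⟩)
  · rw [Set.mem_singleton_iff] at hq
    subst hq
    exact mem_span_X_of_weight _ fun m hm => le_trans (by norm_num) (hP m hm)
  · exact mem_span_X_of_weight _ fun m hm => le_trans (by norm_num) (weight_pderiv_le _ hP i m hm)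
  · exact mem_span_X_of_weight _ fun m hm => le_trans (by norm_num) (weight_pderiv_le _ (weight_pderiv_le _ hP ij.2) ij.1 m hm)

end Cubic

/-! ## §3 The criterion -/

section Criterion

variable {k : Type} [Field k]

/-- ★★ **A SECOND EQUIMULTIPLE COORDINATE SUBSPACE KILLS `TopLocusIs`**: if the stage is permissible along `Z′ = V(x, y_n : n ∈ Nor′)` and `Z′ ⊄ Z = V(x, y_n : n ∈ Nor)` (some
`n ∈ Nor ∖ Nor′`), then `Z` is not the top locus: `¬ TopLocusIs S Nor`. Mechanism: `TopLocusIs` provides `g` with `g(0) ≠ 0` and `g·y_n^M ∈ J₃(P) ⊆ I_{Z′}`; but the monomial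
`y_n^M` of `g·y_n^M` (coefficient `g(0)`) touches no letter of `(x, Nor′)`. [OURS · L1 W4.5a] -/
theorem not_topLocusIs_of_permissible (S : Stage k) {Nor Nor' : Finset Letter} (h : Permissible S Nor') (hn : ∃ n ∈ Nor, n ∉ Nor') :
    ¬ TopLocusIs S Nor := by
  classical
  rintro ⟨-, g, hg0, M, -, hgy⟩
  obtain ⟨n, hn, hn'⟩ := hn
  have hmem := J₃_le_span_of_permissible S Nor' h (hgy n hn)
  rw [mem_ideal_span_X_image] at hmem
  have hcoeff : coeff (Finsupp.single (Option.some n) M) (g * X (Option.some n) ^ M) = coeff 0 g := by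
    rw [X_pow_eq_monomial, coeff_mul_monomial', if_pos le_rfl, tsub_self, mul_one]
  have hg0' : coeff 0 g ≠ 0 := by
    have := congrFun (MvPolynomial.constantCoeff_eq (σ := Option Letter) (R := k)) g
    rw [MvPolynomial.eval_zero'] at hg0
    rwa [← this]
  have hsupp : Finsupp.single (Option.some n) M ∈ (g * X (Option.some n) ^ M).support := by
    rw [MvPolynomial.mem_support_iff, hcoeff]; exact hg0'
  obtain ⟨i, hi, hne⟩ := hmem _ hsupp
  rw [Finsupp.single_apply_ne_zero] at hne
  obtain ⟨rfl, -⟩ := hne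
  rw [Finset.coe_insert, Set.mem_insert_iff, Finset.coe_image, Set.mem_image] at hi
  rcases hi with h0 | ⟨n', hn'mem, hnn'⟩
  · exact Option.some_ne_none _ h0
  · rw [Finset.mem_coe] at hn'mem
    exact hn' (Option.some_injective _ hnn' ▸ hn'mem)

/-- The same with the inclusion failure stated as `¬ Nor ⊆ Nor′`. [OURS · L1 W4.5a] -/
theorem not_topLocusIs_of_permissible' (S : Stage k) {Nor Nor' : Finset Letter} (h : Permissible S Nor') (hn : ¬ Nor ⊆ Nor') :
    ¬ TopLocusIs S Nor :=
  not_topLocusIs_of_permissible S h (Finset.not_subset.mp hn)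

end Criterion

end Summit.ResolutionOfSingularities.ResolutionOfSingularities.Theorems.FInjectiveMacaulayfication.LastCentreTopLocus

end
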